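import Literature.AlgebraicGeometry.Resolution.InseparableLocalUniformizationHeightStepTwo
import Literature.AlgebraicGeometry.Resolution.InseparableLocalUniformizationEngineTower
import HarnessLib

/-!
# Inseparable local uniformization, §4.2: Step 2 of the induction on the height, re-threaded through the corrected Steps 3–4

Topic: `Literature/AlgebraicGeometry/Resolution`. M. Temkin, *Inseparable local uniformization*,
J. Algebra 373 (2013) 65–119 = arXiv:0804.1554v3, §4.2 "Induction on height", Step 2 (p. 51;
p. 31 of the 41-pp. arXiv version held in the literature store): "Following the argument from
Step 3 in §4.1, we deduce from Lemma 2.8.4 that refining `Y` via `Y′ → Y` and updating `X` as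
`Nr_η(Y′ ×_Y X)` we can achieve that `K°` is centered on a point `z ∈ X` which is
smooth-equivalent to the center `y_m` of `m°` on `Y_m := Nr_m(Y)`. By Theorem 4.1.1 applied to
`Y`, `k̄°` and `m°` … the center of `K°` on `X` is `l`-smooth".

`InseparableLocalUniformizationHeightStepTwo.lean` PROVES this step as
`relConclusion_of_normalForm_nft : Temkin2013_Lemma332_nft → Temkin2013_Steps34 →
Temkin2013Descent → …`. The named fact `Temkin2013_Steps34` taken there is MIS-RENDERED (its
binders `[Algebra k̄ K₁] [IsScalarTower k̄ K K₁]` leave the `k̄`-structure of `K₁` free, see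
`InseparableLocalUniformizationEngineTower.lean`, which vendors the corrected, weaker
`Temkin2013_Steps34_tower` and proves `Temkin2013_Steps34 → Temkin2013_Steps34_tower`). The
proof of Step 2 only USES the corrected specialisation — it applies Steps 3–4 with `K₁ = K`
carrying its own structure — so it goes through VERBATIM with the weaker hypothesis; this file
records that:

* `relConclusion_of_normalForm_nft_tower :
    Temkin2013_Lemma332_nft → Temkin2013_Steps34_tower → Temkin2013Descent → …` — PROVED
  (proof text = that of `relConclusion_of_normalForm_nft`, hypothesis weakened).

The induction on the height and the frontier of `Temkin2013HeightStepOfDescent` are moved to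
the corrected fact in `InseparableLocalUniformizationHeightInductionTower.lean`.

## Sources

* M. Temkin, *Inseparable local uniformization*, arXiv:0804.1554v3, §4.2, Step 2 (p. 51);
  proof of Thm. 4.1.1, Steps 2–4 (pp. 48–49); Lemma 3.3.2 (p. 46).
-/

noncomputable section

open IsLocalRing

namespace Literature.AlgebraicGeometry.Resolution

universe u

section stepTwo

variable {k K : Type u} [Field k] [Field K] [Algebra k K]

-- the final transport of Lemma 3.3.2's smooth-equivalence into the shape of `Temkin2013_Steps34`
-- unfolds several `codRestrict`/`etaModelBaseMap` definitions (twice the default budget)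
set_option maxHeartbeats 400000 in
/-- **Step 2 of the induction on the height** (Temkin 2013, §4.2, Step 2, p. 51: "The theorem
holds true if the condition of Step 1 is satisfied"), PROVED from Lemma 3.3.2 (the corrected
rendering `Temkin2013_Lemma332_nft`, whose finiteness hypothesis "`K/k̄` finitely generated" holds
here as `K/k` is), Steps 3–4 of the proof of Thm. 4.1.1 in their CORRECTED rendering (`Temkin2013_Steps34_tower`,
`InseparableLocalUniformizationEngineTower.lean`) and Thm. 4.1.1 (`Temkin2013Descent`, "By Theorem 4.1.1 applied to `Y`, `k̄°` and `m°`"). The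
"condition of Step 1" (normal form): `K° = O ⊆ O₁ = F°`; `k̄` an intermediate field, finitely
generated over `k`, with `k̄° = K° ∩ k̄` of height one; `Y = Spec B` an affine `k`-model of `k̄°`
inside `k̄`; `X = Spec A` a NORMAL affine model of `K°` containing `B`; and the centre `x` of `F°`
on the generic fibre `X_η = Spec k̄[A]` a closed point (`k(x) = k̄[A]/x` integral over `k̄`) which
is simple (`k(x)/k̄` separable) and `k̄`-smooth. Conclusion: the conclusion of (the corrected)
Thm. 1.3.2 for `(k, K, K°, X)`.
[cite: Temkin2013, Section 4.2, Step 2 (arXiv:0804.1554v3 p. 51)] -/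
theorem relConclusion_of_normalForm_nft_tower (h332 : Temkin2013_Lemma332_nft.{u})
    (h34 : Temkin2013_Steps34_tower.{u}) (hD : Temkin2013Descent.{u})
    (hfg : (⊤ : IntermediateField k K).FG) (O : ValuationSubring K)
    (hk : ∀ c : k, algebraMap k K c ∈ O) (O₁ : ValuationSubring K) (h01 : O ≤ O₁)
    (kb : IntermediateField k K) (hkbfg : (⊤ : IntermediateField k kb).FG)
    (hdim1 : ringKrullDim (O.comap (algebraMap kb K)) = 1)
    (B : Subalgebra k kb) (hBO : B.toSubring ≤ (O.comap (algebraMap kb K)).toSubring)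
    (hBfg : B.FG) (hBfr : IsFractionRing B kb)
    (A : Subalgebra k K) (hAO : A.toSubring ≤ O.toSubring) (hAfg : A.FG)
    (hAfr : IsFractionRing A K) (hAn : ∀ x : K, IsIntegral A x → x ∈ A)
    (hBA : ∀ b : B, algebraMap kb K b ∈ A)
    (hAη : (Algebra.adjoin kb (A : Set K)).toSubring ≤ O₁.toSubring)
    (hint : Algebra.IsIntegral kb
      (↥(Algebra.adjoin kb (A : Set K)) ⧸ centreIdeal (Algebra.adjoin kb (A : Set K)) O₁ hAη))
    (hsm : Algebra.IsSmoothAt kb (centreIdeal (Algebra.adjoin kb (A : Set K)) O₁ hAη))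
    (hsep : Algebra.IsSeparable kb
      (↥(Algebra.adjoin kb (A : Set K)) ⧸ centreIdeal (Algebra.adjoin kb (A : Set K)) O₁ hAη)) :
    Temkin2013RelConclusion k K O A := by
  classical
  -- the base valuation ring `k̄° = K° ∩ k̄`, of height one and equal characteristic
  set Okb : ValuationSubring kb := O.comap (algebraMap kb K) with hOkb
  have hdimle : ringKrullDim Okb ≤ 1 := hdim1.le
  have hkOkb : ∀ c : k, algebraMap k kb c ∈ Okb := fun c => by
    change algebraMap kb K (algebraMap k kb c) ∈ O
    rw [← IsScalarTower.algebraMap_apply]; exact hk c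
  have hchar : ringChar (IsLocalRing.ResidueField Okb) = ringChar kb :=
    ringChar_residueField_eq_of_algebraMap_mem Okb hkOkb
  -- the closed point `x` and its residue field `m = k(x)`
  set Aη : Subalgebra kb K := Algebra.adjoin kb (A : Set K) with hAηdef
  set x := centreIdeal Aη O₁ hAη with hxdef
  haveI : Algebra.IsIntegral kb (Aη ⧸ x) := hint
  haveI hxmax : x.IsMaximal := Ideal.Quotient.maximal_of_isField _
    (isField_of_isIntegral_of_isField' (R := kb) (S := Aη ⧸ x) (Field.toIsField kb))
  letI : Field (Aη ⧸ x) := Ideal.Quotient.field x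
  let φ : Aη →ₐ[kb] Aη ⧸ x := Ideal.Quotient.mkₐ kb x
  have hφ : Function.Surjective φ := Ideal.Quotient.mkₐ_surjective kb x
  let ψ := quotCentreToResidueField O₁ kb Aη hAη
  have hψφ : ∀ a : Aη, ψ (φ a) = residue O₁ ⟨(a : K), hAη a.2⟩ := fun a => rfl
  let Om : ValuationSubring (Aη ⧸ x) := residuePointValuationSubring O O₁ h01 ψ
  have hOm : Om.comap (algebraMap kb (Aη ⧸ x)) = Okb :=
    residuePointValuationSubring_comap O O₁ h01 kb Aη hAη φ ψ hψφ
  -- `X_S = Nr_K(X ×_Y S)`, an affine normalized `S`-model with generic fibre `X_η`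
  set R₀ : Subring kb := Okb.toSubring with hR₀
  have hR₀O : ∀ c ∈ R₀, algebraMap kb K c ∈ O := fun c hc => hc
  obtain ⟨t, ht⟩ := hAfg
  set XS : Subring K := etaModel kb (nrIn A.toSubring) R₀ with hXSdef
  have hXSmodel : IsAffineNormalizedModel ⊤ (R₀.map (algebraMap kb K)) XS :=
    isAffineNormalizedModel_etaModel A t ht hAfr R₀ hkOkb
  have hXSO : XS ≤ O.toSubring := etaModel_le_valuationSubring A O hAO R₀ hR₀O
  have hB' : ∀ z : kb, ∃ a ∈ B.toSubring, ∃ b ∈ B.toSubring, z = a / b := fun z => by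
    haveI := hBfr
    obtain ⟨a, b, -, rfl⟩ := IsFractionRing.div_surjective (A := B) z
    exact ⟨a, a.2, b, b.2, rfl⟩
  have hBA' : B.toSubring.map (algebraMap kb K) ≤ A.toSubring := by
    rintro _ ⟨b, hb, rfl⟩; exact hBA ⟨b, hb⟩
  have hadj : Algebra.adjoin kb (XS : Set K) = Aη := adjoin_etaModel_eq A hAn B.toSubring hB' hBA' R₀
  have hAη' : (Algebra.adjoin kb (XS : Set K)).toSubring ≤ O₁.toSubring := by rw [hadj]; exact hAη
  -- Lemma 3.3.2's data in terms of `k̄[X_S]`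
  let e : Algebra.adjoin kb (XS : Set K) ≃ₐ[kb] Aη := Subalgebra.equivOfEq _ _ hadj
  have he : ∀ a : Algebra.adjoin kb (XS : Set K), (e a : K) = a := fun a => rfl
  let φ' : Algebra.adjoin kb (XS : Set K) →ₐ[kb] Aη ⧸ x := φ.comp e.toAlgHom
  have hφ' : Function.Surjective φ' := hφ.comp e.surjective
  set x' : Ideal (Algebra.adjoin kb (XS : Set K)) := centreIdeal _ O₁ hAη' with hx'def
  have hker' : RingHom.ker (φ' : Algebra.adjoin kb (XS : Set K) →+* Aη ⧸ x) = x' := by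
    ext a
    rw [RingHom.mem_ker]
    change Ideal.Quotient.mk x (e a) = 0 ↔ a ∈ x'
    rw [Ideal.Quotient.eq_zero_iff_mem]
    rfl
  have hsm' : Algebra.IsSmoothAt kb x' := (isSmoothAt_centreIdeal_congr hadj O₁ hAη' hAη).mpr hsm
  have hiA : ∀ a : XS, φ' ⟨a, Algebra.subset_adjoin a.2⟩ ∈ Om := fun a =>
    (map_mem_residuePointValuationSubring_iff O O₁ h01 kb Aη hAη φ ψ hψφ _).mpr (hXSO a.2)
  obtain ⟨A'S, hXA', hA'model, hA'le, hi', hkA', hkm, hASE⟩ :=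
    h332 kb K Okb hchar hdim1 XS hXSmodel (intermediateField_fg_top_of_fg_top kb hfg) (Aη ⧸ x) φ'
      hφ' x' hker' hsm' hsep Om hOm hiA
  -- `A′_S ⊆ K°` (its image in `m` lies in `m°`)
  have hA'SO : A'S ≤ O.toSubring := fun a ha =>
    (map_mem_residuePointValuationSubring_iff O O₁ h01 kb Aη hAη φ ψ hψφ
      (e ⟨a, hA'le a ha⟩)).mp (hi' ⟨a, ha⟩)
  -- the refinement `X′ = Nr_K(A[f])` of `X` with `Nr_K(X′ ×_Y S) = A′_S`
  obtain ⟨s', -, hA'Sset, -⟩ := hA'model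
  obtain ⟨C', hC'⟩ : ∃ C' : Subring K,
      C' = Subring.closure (↑(R₀.map (algebraMap kb K)) ∪ (s' : Set K)) := ⟨_, rfl⟩
  have hA'SC' : A'S = nrIn C' := by
    apply SetLike.coe_injective
    rw [hA'Sset, hC']
    rfl
  have hs'A'S : (s' : Set K) ⊆ A'S := fun y hy => by
    rw [hA'SC']
    exact le_nrIn C' (by rw [hC']; exact Subring.subset_closure (Or.inr hy))
  have htA : (t : Set K) ⊆ A := by rw [← ht]; exact Algebra.subset_adjoin
  set A₁ : Subalgebra k K := Algebra.adjoin k (↑t ∪ ↑s') with hA₁def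
  have hAA₁ : A ≤ A₁ := by rw [← ht]; exact Algebra.adjoin_mono Set.subset_union_left
  have hA₁fg : A₁.FG := ⟨t ∪ s', by rw [Finset.coe_union]⟩
  let Oalg : Subalgebra k K := { O.toSubring.toSubsemiring with algebraMap_mem' := hk }
  have hA₁O : A₁.toSubring ≤ O.toSubring := by
    have : A₁ ≤ Oalg := Algebra.adjoin_le (Set.union_subset (htA.trans hAO)
      (hs'A'S.trans hA'SO))
    exact fun y hy => this hy
  have hA₁fr : IsFractionRing A₁ K := by
    haveI := hAfr
    refine IsFractionRing.of_field A₁ K fun z => ?_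
    obtain ⟨a, b, -, rfl⟩ := IsFractionRing.div_surjective (A := A) z
    exact ⟨⟨a, hAA₁ a.2⟩, ⟨b, hAA₁ b.2⟩, rfl⟩
  obtain ⟨A₂, hA₁A₂, hA₂O, hA₂fg, hA₂fr, hA₂n, hA₂set⟩ :=
    exists_normal_affineModel_ge' O A₁ hA₁O hA₁fg hA₁fr
  have hAA₂ : A ≤ A₂ := hAA₁.trans hA₁A₂
  have hBA₂ : ∀ b : B, algebraMap kb K b ∈ A₂ := fun b => hAA₂ (hBA b)
  -- `etaModel k̄ (Nr_K A₂) k̄° = A′_S`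
  have hA₂nr : A₂.toSubring = nrIn A₁.toSubring := by
    apply SetLike.coe_injective
    change (A₂ : Set K) = (nrIn A₁.toSubring : Set K)
    rw [hA₂set]
    rfl
  have hkey : etaModel kb (nrIn (A₂.toSubring.map (algebraMap K K))) R₀ = A'S := by
    rw [subring_map_algebraMap_self, hA₂nr, nrIn_nrIn, hA'SC']
    refine nrIn_eq_nrIn_of_le_of_le (sup_le ?_ ?_) ?_
    · -- `Nr_K(A₁) ≤ Nr_K(C′)` since `A₁ = k[t, s′] ⊆ Nr_K(C′)`
      have h1 : A₁.toSubring ≤ nrIn C' := by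
        rw [hA₁def, Algebra.adjoin_eq_ring_closure, Subring.closure_le]
        rintro y (⟨c, rfl⟩ | hy | hy)
        · refine le_nrIn C' ?_
          rw [hC']
          refine Subring.subset_closure (Or.inl ⟨algebraMap k kb c, hkOkb c, ?_⟩)
          exact (IsScalarTower.algebraMap_apply k kb K c).symm
        · rw [← hA'SC']; exact hXA' (le_etaModel _ _ (le_nrIn _ (htA hy)))
        · rw [← hA'SC']; exact hs'A'S hy
      have h2 := nrIn_mono h1
      rwa [nrIn_nrIn] at h2
    · refine (le_nrIn C').trans' ?_
      rw [hC']; exact fun y hy => Subring.subset_closure (Or.inl hy)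
    · refine (le_nrIn _).trans' ?_
      rw [hC', Subring.closure_le]
      refine Set.union_subset (fun y hy => (le_sup_right : R₀.map (algebraMap kb K) ≤ _) hy)
        fun y hy => (le_sup_left : nrIn A₁.toSubring ≤ _) (le_nrIn _ ?_)
      exact Algebra.subset_adjoin (Or.inr hy)
  -- Steps 3–4 (`Temkin2013_Steps34`) for `X′ = Spec A₂`, `K₁ = K`, `m = k(x)`, `m°`
  have hDY : Temkin2013DescentFor k kb Okb := hD k kb hkbfg Okb hkOkb hdimle
  have hAηfg : Aη.FG := ⟨t, by rw [hAηdef, ← ht, Algebra.adjoin_adjoin_of_tower]⟩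
  haveI : Algebra.FiniteType kb Aη := (Subalgebra.fg_iff_finiteType _).mp hAηfg
  haveI : Algebra.FiniteType kb (Aη ⧸ x) := Algebra.FiniteType.of_surjective φ hφ
  haveI : FiniteDimensional kb (Aη ⧸ x) := Algebra.IsIntegral.finite
  have hOcomap : O.comap (algebraMap K K) = O := by ext; rfl
  have hXS₂ : etaModel kb (nrIn (A₂.toSubring.map (algebraMap K K))) Okb.toSubring ≤
      O.toSubring := by rw [hkey]; exact hA'SO
  have hOm₂ : ∀ c : Okb.toSubring, algebraMap kb (Aη ⧸ x) c ∈ Om := fun c => by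
    have : (c : kb) ∈ Om.comap (algebraMap kb (Aη ⧸ x)) := by rw [hOm]; exact c.2
    exact this
  -- the smooth-equivalence hypothesis of `Temkin2013_Steps34`, transported from Lemma 3.3.2's
  have hASE₂ : AreSmoothEquivalent
      (etaModelBaseMap (nrIn (A₂.toSubring.map (algebraMap K K))) Okb.toSubring)
      (((algebraMap kb (Aη ⧸ x)).comp Okb.toSubring.subtype).codRestrict Om hOm₂)
      ((IsLocalRing.maximalIdeal O).comap (Subring.inclusion hXS₂))
      (IsLocalRing.maximalIdeal Om) := by
    subst hkey
    have hpt : (IsLocalRing.maximalIdeal Om).comap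
        (liftToValuationSubring (Algebra.adjoin kb (XS : Set K)) φ' _ hA'le Om hi') =
        (IsLocalRing.maximalIdeal O).comap (Subring.inclusion hXS₂) := by
      refine Ideal.ext fun a => ?_
      rw [Ideal.mem_comap, Ideal.mem_comap]
      exact map_mem_maximalIdeal_residuePoint_iff O O₁ h01 kb Aη hAη φ ψ hψφ
        (e ⟨a, hA'le a a.2⟩) (hA'SO a.2)
    rw [← hpt]
    exact hASE
  have hconcl := h34 k K hfg O hk kb hkbfg hdimle hDY B hBO hBfg hBfr A₂ hA₂O hA₂fg hA₂fr hA₂n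
    hBA₂ K inferInstance O hOcomap (Aη ⧸ x) inferInstance Om hOm hXS₂ hOm₂ hASE₂
  exact Temkin2013RelConclusion.of_le O hAA₂
    (Temkin2013DescentConclusion.relConclusion_self O A₂ hconcl)


end stepTwo

end Literature.AlgebraicGeometry.Resolution
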